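import Summits.HodgeConjecture.HodgeConjecture.Theorems.F0P3cStCharTSSaHeadTorus10    -- ★ (S-a) head: the organ's vocabulary (`Gqs`, `finExplicitCollection`, `IsLocalDeltaTransfer`, `hyperbolicSet` via TorusDefs, …)
import HarnessLib

/-!
# F0 · P3c · line LH6 «StCharTS» — «DATUM-WITNESS v0»: the §12.5 datum structure `Ch12Sec5.EllipticData (U(Φ₃)(L⁺_v)) (H_v)` INSTANTIATED with the organs'
# objects and the datum road's field shapes — the structure literal of the future rung-0 constructor, kernel-checked (no Defs file)

Cell `pub/hodgecm-mathlib`, crux H413 = `stmt-HodgeConjecture-24833` (lane `--supports …`), route HCCMUnconditional; seat LH6-p01 (g4) (slice-map owner).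
THEOREMS ONLY (no definition ∕ instance ∕ notation ∕ named fact ∕ `sorry`); ★-only imports.

WHAT.  `exists_datum_with_fields`: for the organs' objects (`νQv`, `νHv`, `μZ`, `mQv`, `mHv`, the Δ‴-matching, `πSt`) and ANY choice of the constructor's data
(`char`, `charH`, `up`, `DG`, `DH`, the elliptic Cartan representatives `Sell`∕`SH` with their measures, the labels `stG detG pi2 piN`, `ι`, `stConj`, `regH`, `ellH`, `τ`),
THERE IS a datum `𝔇 : EllipticData (Gqs L v) H_v` whose fields satisfy — by `rfl` ∕ `Iff.rfl` — exactly the COMPAT clauses of (S-𝔇) and the FIELD EQUATIONS that the ★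
slices and ★ `F0P3cStCharTSDatumJunction.ellipticPackage_body_of_inputs` (p851346) consume: `regG := {IsRegularElt}`, `ellG := G^r ∖ Ω` (★ S2), `cartanAll := {M} ∪ Sell`,
`cartanG := Sell` (★ S9a), `ldsPackets := ` the two-element JH-sets of reducible unitary principal series (★ S5), `irredPS :=` the irreducible principal series (★ S7),
`sqPacketsH := {{St_H(ξ_v)}}` (COMPAT #7; every «∀ ρ ∈ Π²(H)» input is then its print instance at that packet), `IsTransfer :=` the Δ‴-matching (COMPAT #6), and the
fifteen §12.5 bookkeeping fields that NO conjunct of (S-𝔇) reads (`stCartan*`, `cartanHG`, `cartanGH`, `weylF`, `Δ`, `dTF`, `twist`, `kappa`, `W`, `cosetReps`,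
`wAct`, `wActΔ`, `down`; S13-CENSUS v1 §1, LH4-p01 (g5)) set to trivial values (honestly: they are placeholders, not print's objects, and nothing filed reads them).
So the rung-0 assembler is `obtain ⟨𝔇₀, h…⟩ := exists_datum_with_fields …` + ★ junction + the ★ ∃-theorems for `char`∕`pi2`∕`piN`∕`par`∕`T` + the two Cartan
∃-facts + the named block.
HONEST LABEL: HC_CM is proved only modulo the 7 printed citations (2 remaining named inputs: hLiu418 = `stmt-HodgeConjecture-24832`, h413 = `stmt-HodgeConjecture-24833`)
until rung 0 closes; this file closes no organ and asserts nothing about print — it only exhibits a structure instance (count-neutral).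

## References
* [Rogawski1990] J. D. Rogawski, *Automorphic Representations of Unitary Groups in Three Variables*, Ann. of Math. Stud. 123 (1990): §12.5 pp. 182–187 (the datum);
  §12.2 pp. 173–174 (labels); §3.6 pp. 28–31 (Cartan subgroups).
-/

set_option autoImplicit false
-- the mandated namespace has the single-problem summit's repeated segment (`HodgeConjecture.HodgeConjecture`)
set_option linter.dupNamespace false

noncomputable section

open NumberField IsDedekindDomain MeasureTheory
open scoped Matrix MatrixGroups
open Literature.NumberTheory.Rogawski1990 Literature.NumberTheory.Automorphic Literature.NumberTheory.Automorphic.UnitaryGroup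
open Literature.NumberTheory.Automorphic.UnitaryGroup.CotangentForms Literature.NumberTheory.GaloisRepresentations
open Literature.NumberTheory.Automorphic.Arthur2013.Leaves.TECR
open Summit.HodgeConjecture.HodgeConjecture.Cruxes.H413.F0P3cStCharTSTorusDefs

namespace Summit.HodgeConjecture.HodgeConjecture.Cruxes.H413.F0P3cStCharTSDatumWitness

set_option maxHeartbeats 1600000 in
-- the statement repeats the organ's field-equation texts ((LDS)/(PS) shapes quote `cmPrincipalSeries`/`IsConstituentOf`), elaboration budget as in the leaf
/-- **«DATUM-WITNESS v0»** — the §12.5 datum exists with the organs' objects and the road's field shapes (all equations by `rfl`∕`Iff.rfl`).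
[cite: Rogawski1990, §12.5 pp. 182–187; §12.2 pp. 173–174] -/
theorem exists_datum_with_fields
    (L : Type) [Field L] [NumberField L] [IsCMField L] (μ : HeckeCharacter L) (v : HeightOneSpectrum (𝓞 ↥(maximalRealSubfield L)))
    [MeasurableSpace ((UnitaryGroup.cmDatum L 2 (Matrix.of fun i j : Fin 2 => if i.val + j.val + 1 = 2 then (1 : L) else 0)).Local v × (UnitaryGroup.cmDatum L 1 (Matrix.of fun i j : Fin 1 => if i.val + j.val + 1 = 1 then (1 : L) else 0)).Local v)] [MeasurableSpace (Gqs L v)]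
    [∀ γ : (Gqs L v), MeasurableSpace ((Gqs L v) ⧸ Subgroup.centralizer ({γ} : Set (Gqs L v)))] [MeasurableSpace ((Gqs L v) ⧸ Subgroup.center (Gqs L v))]
    (νHv : Measure ((UnitaryGroup.cmDatum L 2 (Matrix.of fun i j : Fin 2 => if i.val + j.val + 1 = 2 then (1 : L) else 0)).Local v × (UnitaryGroup.cmDatum L 1 (Matrix.of fun i j : Fin 1 => if i.val + j.val + 1 = 1 then (1 : L) else 0)).Local v)) (νQv : Measure (Gqs L v)) (μZ : Measure ((Gqs L v) ⧸ Subgroup.center (Gqs L v)))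
    [∀ a : ((UnitaryGroup.cmDatum L 2 (Matrix.of fun i j : Fin 2 => if i.val + j.val + 1 = 2 then (1 : L) else 0)).Local v × (UnitaryGroup.cmDatum L 1 (Matrix.of fun i j : Fin 1 => if i.val + j.val + 1 = 1 then (1 : L) else 0)).Local v), MeasurableSpace (((UnitaryGroup.cmDatum L 2 (Matrix.of fun i j : Fin 2 => if i.val + j.val + 1 = 2 then (1 : L) else 0)).Local v × (UnitaryGroup.cmDatum L 1 (Matrix.of fun i j : Fin 1 => if i.val + j.val + 1 = 1 then (1 : L) else 0)).Local v) ⧸ Subgroup.centralizer ({a} : Set ((UnitaryGroup.cmDatum L 2 (Matrix.of fun i j : Fin 2 => if i.val + j.val + 1 = 2 then (1 : L) else 0)).Local v × (UnitaryGroup.cmDatum L 1 (Matrix.of fun i j : Fin 1 => if i.val + j.val + 1 = 1 then (1 : L) else 0)).Local v)))]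
    (mHv : OrbitalMeasureFamily ((UnitaryGroup.cmDatum L 2 (Matrix.of fun i j : Fin 2 => if i.val + j.val + 1 = 2 then (1 : L) else 0)).Local v × (UnitaryGroup.cmDatum L 1 (Matrix.of fun i j : Fin 1 => if i.val + j.val + 1 = 1 then (1 : L) else 0)).Local v)) (mQv : OrbitalMeasureFamily (Gqs L v)) (πSt : IrrClass ((UnitaryGroup.cmDatum L 2 (Matrix.of fun i j : Fin 2 => if i.val + j.val + 1 = 2 then (1 : L) else 0)).Local v × (UnitaryGroup.cmDatum L 1 (Matrix.of fun i j : Fin 1 => if i.val + j.val + 1 = 1 then (1 : L) else 0)).Local v))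
    -- the constructor's choices (each supplied by a ★ ∃-theorem or a named ∃-fact at rung-0 time)
    (ι : ((UnitaryGroup.cmDatum L 2 (Matrix.of fun i j : Fin 2 => if i.val + j.val + 1 = 2 then (1 : L) else 0)).Local v × (UnitaryGroup.cmDatum L 1 (Matrix.of fun i j : Fin 1 => if i.val + j.val + 1 = 1 then (1 : L) else 0)).Local v) →* (Gqs L v)) (stConjG : (Gqs L v) → (Gqs L v) → Prop) (stConjH : ((UnitaryGroup.cmDatum L 2 (Matrix.of fun i j : Fin 2 => if i.val + j.val + 1 = 2 then (1 : L) else 0)).Local v × (UnitaryGroup.cmDatum L 1 (Matrix.of fun i j : Fin 1 => if i.val + j.val + 1 = 1 then (1 : L) else 0)).Local v) → ((UnitaryGroup.cmDatum L 2 (Matrix.of fun i j : Fin 2 => if i.val + j.val + 1 = 2 then (1 : L) else 0)).Local v × (UnitaryGroup.cmDatum L 1 (Matrix.of fun i j : Fin 1 => if i.val + j.val + 1 = 1 then (1 : L) else 0)).Local v) → Prop) (regH ellH : Set ((UnitaryGroup.cmDatum L 2 (Matrix.of fun i j : Fin 2 => if i.val + j.val + 1 = 2 then (1 : L) else 0)).Local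 v × (UnitaryGroup.cmDatum L 1 (Matrix.of fun i j : Fin 1 => if i.val + j.val + 1 = 1 then (1 : L) else 0)).Local v))
    (Sell : Finset (Subgroup (Gqs L v))) (SH : Finset (Subgroup ((UnitaryGroup.cmDatum L 2 (Matrix.of fun i j : Fin 2 => if i.val + j.val + 1 = 2 then (1 : L) else 0)).Local v × (UnitaryGroup.cmDatum L 1 (Matrix.of fun i j : Fin 1 => if i.val + j.val + 1 = 1 then (1 : L) else 0)).Local v)))
    (DGf : (Gqs L v) → ℝ) (DHf : ((UnitaryGroup.cmDatum L 2 (Matrix.of fun i j : Fin 2 => if i.val + j.val + 1 = 2 then (1 : L) else 0)).Local v × (UnitaryGroup.cmDatum L 1 (Matrix.of fun i j : Fin 1 => if i.val + j.val + 1 = 1 then (1 : L) else 0)).Local v) → ℝ) (tau : ((UnitaryGroup.cmDatum L 2 (Matrix.of fun i j : Fin 2 => if i.val + j.val + 1 = 2 then (1 : L) else 0)).Local v × (UnitaryGroup.cmDatum L 1 (Matrix.of fun i j : Fin 1 => if i.val + j.val + 1 = 1 then (1 : L) else 0)).Local v) → ℂ)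
    (μTf : (T : Subgroup (Gqs L v)) → Measure ↥T) (μTHf : (T : Subgroup ((UnitaryGroup.cmDatum L 2 (Matrix.of fun i j : Fin 2 => if i.val + j.val + 1 = 2 then (1 : L) else 0)).Local v × (UnitaryGroup.cmDatum L 1 (Matrix.of fun i j : Fin 1 => if i.val + j.val + 1 = 1 then (1 : L) else 0)).Local v)) → Measure ↥T)
    (char : IrrClass (Gqs L v) → (Gqs L v) → ℂ) (charH : IrrClass ((UnitaryGroup.cmDatum L 2 (Matrix.of fun i j : Fin 2 => if i.val + j.val + 1 = 2 then (1 : L) else 0)).Local v × (UnitaryGroup.cmDatum L 1 (Matrix.of fun i j : Fin 1 => if i.val + j.val + 1 = 1 then (1 : L) else 0)).Local v) → ((UnitaryGroup.cmDatum L 2 (Matrix.of fun i j : Fin 2 => if i.val + j.val + 1 = 2 then (1 : L) else 0)).Local v × (UnitaryGroup.cmDatum L 1 (Matrix.of fun i j : Fin 1 => if i.val + j.val + 1 = 1 then (1 : L) else 0)).Local v) → ℂ) (upf : (((UnitaryGroup.cmDatum L 2 (Matrix.of fun i j : Fin 2 => if i.val + j.val + 1 = 2 then (1 : L) else 0)).Local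 v × (UnitaryGroup.cmDatum L 1 (Matrix.of fun i j : Fin 1 => if i.val + j.val + 1 = 1 then (1 : L) else 0)).Local v) → ℂ) → ((Gqs L v) → ℂ))
    (stG detG : (↥(Subgroup.center (Gqs L v)) →* ℂˣ) → IrrClass (Gqs L v)) (pi2 piN : (((UnitaryGroup.cmDatum L 2 (Matrix.of fun i j : Fin 2 => if i.val + j.val + 1 = 2 then (1 : L) else 0)).Local v × (UnitaryGroup.cmDatum L 1 (Matrix.of fun i j : Fin 1 => if i.val + j.val + 1 = 1 then (1 : L) else 0)).Local v) →* ℂˣ) → IrrClass (Gqs L v)) :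
    ∃ 𝔇 : Ch12Sec5.EllipticData (Gqs L v) ((UnitaryGroup.cmDatum L 2 (Matrix.of fun i j : Fin 2 => if i.val + j.val + 1 = 2 then (1 : L) else 0)).Local v × (UnitaryGroup.cmDatum L 1 (Matrix.of fun i j : Fin 1 => if i.val + j.val + 1 = 1 then (1 : L) else 0)).Local v),
      𝔇.μG = νQv ∧ 𝔇.μH = νHv ∧ 𝔇.μGZ = μZ ∧ 𝔇.orb = mQv ∧
      (∀ γ : (Gqs L v), γ ∈ 𝔇.regG ↔ IsRegularElt (γ.val : GL (Fin 3) (UnitaryGroup.LocalRing L v))) ∧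
      (∀ (φ : (Gqs L v) → ℂ) (fH : ((UnitaryGroup.cmDatum L 2 (Matrix.of fun i j : Fin 2 => if i.val + j.val + 1 = 2 then (1 : L) else 0)).Local v × (UnitaryGroup.cmDatum L 1 (Matrix.of fun i j : Fin 1 => if i.val + j.val + 1 = 1 then (1 : L) else 0)).Local v) → ℂ), 𝔇.IsTransfer φ fH ↔ IsLocalDeltaTransfer L (qsForm L) v ((finExplicitCollection L (qsForm L) μ (finExplicitDelta_conj_left_all L (qsForm L) μ) (finExplicitDelta_conj_right_all L (qsForm L) μ)) v) mHv mQv fH φ) ∧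
      ({πSt} : Finset (IrrClass ((UnitaryGroup.cmDatum L 2 (Matrix.of fun i j : Fin 2 => if i.val + j.val + 1 = 2 then (1 : L) else 0)).Local v × (UnitaryGroup.cmDatum L 1 (Matrix.of fun i j : Fin 1 => if i.val + j.val + 1 = 1 then (1 : L) else 0)).Local v))) ∈ 𝔇.sqPacketsH ∧
      (∀ γ : (Gqs L v), γ ∈ 𝔇.ellG ↔ IsRegularElt (γ.val : GL (Fin 3) (UnitaryGroup.LocalRing L v)) ∧ γ ∉ hyperbolicSet L v) ∧
      𝔇.char = char ∧ 𝔇.charH = charH ∧ 𝔇.up = upf ∧ 𝔇.DG = DGf ∧ 𝔇.DH = DHf ∧ 𝔇.ι = ι ∧ 𝔇.tau = tau ∧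
      (∀ T : Subgroup (Gqs L v), T ∈ 𝔇.cartanAll ↔ T = (cmBorelTriple L 3 v).M ∨ T ∈ 𝔇.cartanG) ∧ 𝔇.cartanG = Sell ∧ 𝔇.cartanH = SH ∧
      (∀ T : Subgroup (Gqs L v), 𝔇.μT T = μTf T) ∧ (∀ T : Subgroup ((UnitaryGroup.cmDatum L 2 (Matrix.of fun i j : Fin 2 => if i.val + j.val + 1 = 2 then (1 : L) else 0)).Local v × (UnitaryGroup.cmDatum L 1 (Matrix.of fun i j : Fin 1 => if i.val + j.val + 1 = 1 then (1 : L) else 0)).Local v), 𝔇.μTH T = μTHf T) ∧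
      𝔇.stG = stG ∧ 𝔇.detG = detG ∧ 𝔇.pi2 = pi2 ∧ 𝔇.piN = piN ∧
      𝔇.sqPacketsH = Set.singleton (({πSt} : Finset (IrrClass ((UnitaryGroup.cmDatum L 2 (Matrix.of fun i j : Fin 2 => if i.val + j.val + 1 = 2 then (1 : L) else 0)).Local v × (UnitaryGroup.cmDatum L 1 (Matrix.of fun i j : Fin 1 => if i.val + j.val + 1 = 1 then (1 : L) else 0)).Local v)))) ∧
      (∀ P : Finset (IrrClass (Gqs L v)), P ∈ 𝔇.ldsPackets ↔ (P.card = 2 ∧ ∃ (χ₁ : (UnitaryGroup.LocalRing L v)ˣ →* ℂˣ) (χ₂ : ↥(normOneUnits (conjLocal L (IsCMField.complexConj L) v)) →* ℂˣ), Continuous (fun x => ((χ₁ x : ℂˣ) : ℂ)) ∧ Continuous (fun x => ((χ₂ x : ℂˣ) : ℂ)) ∧ (∀ a : (UnitaryGroup.LocalRing L v)ˣ, (conjLocal L (IsCMField.complexConj L) v) (a : (UnitaryGroup.LocalRing L v)) = a → χ₁ a = 1) ∧ χ₁ ≠ 1 ∧ ∀ c : IrrClass (Gqs L v), c ∈ P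 ↔ c.IsConstituentOf (UnitaryGroup.cmPrincipalSeries L 3 v (UnitaryGroup.cmTorusCharPair L v χ₁ χ₂)))) ∧
      (∀ π ∈ 𝔇.irredPS, (∃ (χ₁ : (UnitaryGroup.LocalRing L v)ˣ →* ℂˣ) (χ₂ : ↥(normOneUnits (conjLocal L (IsCMField.complexConj L) v)) →* ℂˣ), Continuous (fun x => ((χ₁ x : ℂˣ) : ℂ)) ∧ Continuous (fun x => ((χ₂ x : ℂˣ) : ℂ)) ∧ (UnitaryGroup.cmPrincipalSeries L 3 v (UnitaryGroup.cmTorusCharPair L v χ₁ χ₂)).IsIrreducible ∧ π.IsConstituentOf (UnitaryGroup.cmPrincipalSeries L 3 v (UnitaryGroup.cmTorusCharPair L v χ₁ χ₂)))) ∧ (∀ π : IrrClass (Gqs L v), (∃ (χ₁ : (UnitaryGroup.LocalRing L v)ˣ →* ℂˣ) (χ₂ : ↥(normOneUnits (conjLocal L (IsCMField.complexConj L) v)) →* ℂˣ), Continuous (fun x => ((χ₁ x : ℂˣ) : ℂ)) ∧ Continuous (fun x => ((χ₂ x : ℂˣ) : ℂ)) ∧ (UnitaryGroup.cmPrincipalSeries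 L 3 v (UnitaryGroup.cmTorusCharPair L v χ₁ χ₂)).IsIrreducible ∧ π.IsConstituentOf (UnitaryGroup.cmPrincipalSeries L 3 v (UnitaryGroup.cmTorusCharPair L v χ₁ χ₂))) → π ∈ 𝔇.irredPS) ∧
      𝔇.stConjG = stConjG ∧ 𝔇.stConjH = stConjH ∧ 𝔇.regH = regH ∧ 𝔇.ellH = ellH := by
  classical
  refine ⟨{
      ι := ι
      regG := (setOf fun γ : (Gqs L v) => IsRegularElt (γ.val : GL (Fin 3) (UnitaryGroup.LocalRing L v)))
      ellG := (setOf fun γ : (Gqs L v) => IsRegularElt (γ.val : GL (Fin 3) (UnitaryGroup.LocalRing L v)) ∧ γ ∉ hyperbolicSet L v)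
      regH := regH
      ellH := ellH
      stConjG := stConjG
      stConjH := stConjH
      cartanAll := insert (cmBorelTriple L 3 v).M Sell
      cartanG := Sell
      stCartanAll := ∅
      stCartanG := ∅
      cartanH := SH
      cartanHG := ∅
      cartanGH := ∅
      weylF := (fun _ => 6)
      Δ := Unit
      dTF := (fun _ => ∅)
      twist := (fun _ _ g => g)
      kappa := (fun _ _ => 0)
      W := Unit
      cosetReps := (fun _ => ∅)
      wAct := (fun _ h => h)
      wActΔ := (fun _ _ d => d)
      DG := DGf
      DH := DHf
      tau := tau
      μG := νQv
      μH := νHv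
      μGZ := μZ
      μT := μTf
      μTH := μTHf
      orb := mQv
      char := char
      charH := charH
      IsTransfer := (fun φ fH => IsLocalDeltaTransfer L (qsForm L) v ((finExplicitCollection L (qsForm L) μ (finExplicitDelta_conj_left_all L (qsForm L) μ) (finExplicitDelta_conj_right_all L (qsForm L) μ)) v) mHv mQv fH φ)
      up := upf
      down := (fun _ _ => 0)
      sqPacketsH := Set.singleton (({πSt} : Finset (IrrClass ((UnitaryGroup.cmDatum L 2 (Matrix.of fun i j : Fin 2 => if i.val + j.val + 1 = 2 then (1 : L) else 0)).Local v × (UnitaryGroup.cmDatum L 1 (Matrix.of fun i j : Fin 1 => if i.val + j.val + 1 = 1 then (1 : L) else 0)).Local v))))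
      ldsPackets := (setOf fun P : Finset (IrrClass (Gqs L v)) => (P.card = 2 ∧ ∃ (χ₁ : (UnitaryGroup.LocalRing L v)ˣ →* ℂˣ) (χ₂ : ↥(normOneUnits (conjLocal L (IsCMField.complexConj L) v)) →* ℂˣ), Continuous (fun x => ((χ₁ x : ℂˣ) : ℂ)) ∧ Continuous (fun x => ((χ₂ x : ℂˣ) : ℂ)) ∧ (∀ a : (UnitaryGroup.LocalRing L v)ˣ, (conjLocal L (IsCMField.complexConj L) v) (a : (UnitaryGroup.LocalRing L v)) = a → χ₁ a = 1) ∧ χ₁ ≠ 1 ∧ ∀ c : IrrClass (Gqs L v), c ∈ P ↔ c.IsConstituentOf (UnitaryGroup.cmPrincipalSeries L 3 v (UnitaryGroup.cmTorusCharPair L v χ₁ χ₂))))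
      stG := stG
      detG := detG
      pi2 := pi2
      piN := piN
      irredPS := (setOf fun π : IrrClass (Gqs L v) => (∃ (χ₁ : (UnitaryGroup.LocalRing L v)ˣ →* ℂˣ) (χ₂ : ↥(normOneUnits (conjLocal L (IsCMField.complexConj L) v)) →* ℂˣ), Continuous (fun x => ((χ₁ x : ℂˣ) : ℂ)) ∧ Continuous (fun x => ((χ₂ x : ℂˣ) : ℂ)) ∧ (UnitaryGroup.cmPrincipalSeries L 3 v (UnitaryGroup.cmTorusCharPair L v χ₁ χ₂)).IsIrreducible ∧ π.IsConstituentOf (UnitaryGroup.cmPrincipalSeries L 3 v (UnitaryGroup.cmTorusCharPair L v χ₁ χ₂)))) },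
    rfl, rfl, rfl, rfl, fun _ => Iff.rfl, fun _ _ => Iff.rfl, Set.mem_singleton _, fun _ => Iff.rfl,
    rfl, rfl, rfl, rfl, rfl, rfl, rfl, fun T => Finset.mem_insert, rfl, rfl, fun _ => rfl, fun _ => rfl,
    rfl, rfl, rfl, rfl, rfl, fun _ => Iff.rfl, fun _ h => h, fun _ h => h, rfl, rfl, rfl, rfl⟩

end Summit.HodgeConjecture.HodgeConjecture.Cruxes.H413.F0P3cStCharTSDatumWitness

end
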